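import Literature.AlgebraicGeometry.Resolution.IdealSheafDescent
import Literature.AlgebraicGeometry.Resolution.RegularSystemOfParameters
import Literature.AlgebraicGeometry.Resolution.RegularLocalRingsFlatDescent
import Literature.AlgebraicGeometry.Resolution.StrictNormalCrossings
import Literature.AlgebraicGeometry.Resolution.MarkedIdeals
import Mathlib.LinearAlgebra.Basis.VectorSpace
import HarnessLib

/-!
# Descent of strict normal crossings along a faithfully flat cover

Topic: `Literature/AlgebraicGeometry/Resolution`. The step of de Jong 1996, 4.5 in which the
strict normal crossings boundary `D̄ ⊂ X̄̄₁` over `k̄` is seen to come from a strict normal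
crossings divisor over a finite extension `k₁` ("`X̄₁` … exist over `k₁` … the quadruple
`(X₁, X̄₁, φ₁, j₁)` is a solution to the problem posed in the theorem", i.e. including
condition (ii) of Thm. 4.1), isolated as a statement about an affine, flat, surjective morphism
`a : Y → Y'` (in 4.5: `X̄̄₁ = X̄₁' ⊗_{k₁} k̄ → X̄₁'`): `IsStrictNormalCrossingsDivisor` (de Jong
1996,
2.4, local form of Stacks 0BI9, `StrictNormalCrossings.lean`) descends from `D = a⁻¹(D')` to `D'`
PROVIDED the ideal sheaf of `D'` and of the image of each irreducible component of `D` pull back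
to the ideal sheaves of `D` and of that component
(`IsStrictNormalCrossingsDivisor.of_comap_vanishingIdeal`).
The proviso is necessary — `x² - t y² = 0` over `k(t)` (`char ≠ 2`) is not a strict normal
crossings divisor at the origin but becomes one over `k(√t)` — and in 4.5 it is what "exist over
`k₁`" provides after enlarging `k₁` (the components are finitely many closed subschemes of finite
presentation).

## Proof

At `p' = a(p)`, `φ : A = 𝒪_{Y',p'} → B = 𝒪_{Y,p}` is flat and local, so `A` is regular
(Matsumura, Thm. 23.7 (i), `IsRegularLocalRing.of_flat_ringHom`). Let `(x₁,…,x_r ; y)` be the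
regular system of parameters of `B` with `I_D·B = (x₁⋯x_r)`. Each `(xᵢ) ⊂ B` is prime; the
closure `Gᵢ` of the corresponding generization `qᵢ` of `p` is an irreducible component of `D`
(a larger irreducible closed subset of `D` has a generic point `ξ ⤳ qᵢ ⤳ p`, i.e. a prime
`𝔯 ⊆ (xᵢ)` of `B` containing `x₁⋯x_r`, forcing `𝔯 = (xᵢ)`), and the stalk at `p` of its ideal
sheaf is `(xᵢ)`. By hypothesis these stalks, and `I_D·B`, are extended from ideals `Qᵢ, I ⊆ A`.
Then (`isRegularLocalRing_and_exists_rsop_of_flat`): `Qᵢ = (fᵢ)` with `φ(fᵢ) = uᵢxᵢ`, `uᵢ`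
units (a finitely generated ideal that becomes principal in the faithfully flat local extension is
principal, `IB ∩ A = I`); the `fᵢ` are linearly independent in `𝔪_A/𝔪_A²` because the `xᵢ` are
in `𝔪_B/𝔪_B²`; they extend to minimal generators `(f ; y')` of `𝔪_A` (`exists_extend_to_rsop`,
Nakayama), `r + e' = emb dim A = dim A`; and `I = (f₁⋯f_r)` again by `IB ∩ A = I`.

## Sources

* A. J. de Jong, *Smoothness, semi-stability and alterations*, Publ. Math. IHÉS 83 (1996), 2.4
  and 4.5 (p. 66).
* H. Matsumura, *Commutative Ring Theory* (1986), Thm. 23.7 (i), Thm. 14.2, §2 (Nakayama).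
* The Stacks Project, Tags 0BI9, 0BIA.
-/

noncomputable section

open CategoryTheory CategoryTheory.Limits AlgebraicGeometry TopologicalSpace IsLocalRing

namespace Literature.AlgebraicGeometry.Resolution

universe u

/-! ## Minimal generators of the maximal ideal of a regular local ring -/

section MinimalGenerators

variable {R : Type u} [CommRing R]

/-- In a regular local ring, a regular system of parameters `z₁, …, z_d` (`d = emb dim R`
generators of `𝔪`) is linearly independent modulo `𝔪²`: if `∑ cᵢ zᵢ ∈ 𝔪²` then all `cᵢ ∈ 𝔪`
(otherwise `zᵢ` would lie in `(z_j : j ≠ i) + 𝔪²`, and Nakayama would make `d - 1` elements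
generate `𝔪`). [folklore] -/
theorem mem_maximalIdeal_of_sum_mul_rsop_mem_sq [IsRegularLocalRing R] {d : ℕ}
    (hd : (maximalIdeal R).spanFinrank = d) (z : Fin d → R)
    (hz : Ideal.span (Set.range z) = maximalIdeal R) (c : Fin d → R)
    (hc : ∑ i, c i * z i ∈ (maximalIdeal R) ^ 2) (i : Fin d) : c i ∈ maximalIdeal R := by
  classical
  by_contra hi
  have hu : IsUnit (c i) := by
    simpa [mem_maximalIdeal, mem_nonunits_iff] using hi
  -- `S` = the other indices
  let S : Set (Fin d) := {j | j ≠ i}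
  have hiS : i ∉ S := fun h => h rfl
  apply not_mem_span_image_of_not_mem hd z hz hiS
  -- `𝔪 ≤ (z_j : j ≠ i) + 𝔪²`, hence `𝔪 ≤ (z_j : j ≠ i)` by Nakayama
  have hzi : z i ∈ Ideal.span (z '' S) ⊔ maximalIdeal R • maximalIdeal R := by
    have hsplit : ∑ j, c j * z j = c i * z i + ∑ j ∈ Finset.univ.erase i, c j * z j :=
      (Finset.add_sum_erase Finset.univ (fun j => c j * z j) (Finset.mem_univ i)).symm
    have hrest : ∑ j ∈ Finset.univ.erase i, c j * z j ∈ Ideal.span (z '' S) := by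
      refine Ideal.sum_mem _ fun j hj => Ideal.mul_mem_left _ _ (Ideal.subset_span ?_)
      exact ⟨j, (Finset.mem_erase.mp hj).1, rfl⟩
    have h1 : c i * z i ∈ Ideal.span (z '' S) ⊔ maximalIdeal R • maximalIdeal R := by
      have : c i * z i = ∑ j, c j * z j - ∑ j ∈ Finset.univ.erase i, c j * z j := by
        rw [hsplit]; ring
      rw [this]
      refine Ideal.sub_mem _ (Ideal.mem_sup_right ?_) (Ideal.mem_sup_left hrest)
      rw [smul_eq_mul, ← pow_two]
      exact hc
    have : z i = hu.unit⁻¹ * (c i * z i) := by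
      rw [← mul_assoc, IsUnit.val_inv_mul, one_mul]
    rw [this]
    exact Ideal.mul_mem_left _ _ h1
  have hle : maximalIdeal R ≤ Ideal.span (z '' S) ⊔ maximalIdeal R • maximalIdeal R := by
    conv_lhs => rw [← hz]
    rw [Ideal.span_le]
    rintro _ ⟨j, rfl⟩
    by_cases hj : j = i
    · subst hj
      exact hzi
    · exact Ideal.mem_sup_left (Ideal.subset_span ⟨j, hj, rfl⟩)
  have hN : maximalIdeal R ≤ Ideal.span (z '' S) :=
    Submodule.le_of_le_smul_of_le_jacobson_bot (IsNoetherian.noetherian _)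
      (IsLocalRing.maximalIdeal_le_jacobson _) hle
  exact hN (hz ▸ Ideal.subset_span ⟨i, rfl⟩ : z i ∈ maximalIdeal R)

/-- Bookkeeping: `emb dim = r + e` from `dim = r + e` in a regular local ring. [folklore] -/
theorem spanFinrank_eq_of_ringKrullDim_eq [IsRegularLocalRing R] {r e : ℕ}
    (hdim : ringKrullDim R = (r + e : ℕ)) : (maximalIdeal R).spanFinrank = r + e := by
  have h := IsRegularLocalRing.spanFinrank_maximalIdeal (R := R)
  rw [hdim] at h
  exact_mod_cast h

/-- Bookkeeping: the appended family `(x, y)` generates the same ideal as `x ∪ y`. [folklore] -/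
theorem span_range_append {r e : ℕ} (x : Fin r → R) (y : Fin e → R) :
    Ideal.span (Set.range (Fin.append x y)) = Ideal.span (Set.range x ∪ Set.range y) := by
  congr 1
  ext a
  simp only [Set.mem_range, Set.mem_union]
  constructor
  · rintro ⟨j, rfl⟩
    refine Fin.addCases (fun j => ?_) (fun j => ?_) j
    · exact Or.inl ⟨j, by simp⟩
    · exact Or.inr ⟨j, by simp⟩
  · rintro (⟨j, rfl⟩ | ⟨j, rfl⟩)
    · exact ⟨Fin.castAdd e j, by simp⟩
    · exact ⟨Fin.natAdd r j, by simp⟩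

/-- In a regular system of parameters `(x ; y)`, `x_l ∈ (x_i)` forces `l = i`. [folklore] -/
theorem eq_of_rsop_mem_span_singleton [IsRegularLocalRing R] {r e : ℕ} (x : Fin r → R)
    (y : Fin e → R) (hdim : ringKrullDim R = (r + e : ℕ))
    (hspan : Ideal.span (Set.range x ∪ Set.range y) = maximalIdeal R) {i l : Fin r}
    (h : x l ∈ Ideal.span {x i}) : l = i := by
  by_contra hli
  have hd := spanFinrank_eq_of_ringKrullDim_eq hdim
  have hz := (span_range_append x y).trans hspan
  have hS : Fin.castAdd e l ∉ ({Fin.castAdd e i} : Set (Fin (r + e))) := by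
    simpa using hli
  apply not_mem_span_image_of_not_mem hd (Fin.append x y) hz hS
  simpa [Set.image_singleton] using h

/-- In a regular system of parameters `(x ; y)`, each `(x_i)` is a prime ideal. [folklore] -/
theorem isPrime_span_singleton_of_rsop [IsRegularLocalRing R] {r e : ℕ} (x : Fin r → R)
    (y : Fin e → R) (hdim : ringKrullDim R = (r + e : ℕ))
    (hspan : Ideal.span (Set.range x ∪ Set.range y) = maximalIdeal R) (i : Fin r) :
    (Ideal.span {x i}).IsPrime := by
  classical
  have hd := spanFinrank_eq_of_ringKrullDim_eq hdim
  have hz := (span_range_append x y).trans hspan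
  have := isPrime_span_image hd (Fin.append x y) hz {Fin.castAdd e i}
  simpa [Set.image_singleton] using this

/-- A regular system of parameters split as `(x₁,…,x_r ; y₁,…,y_e)`: if
`∑ cᵢ xᵢ + ∑ c'ⱼ yⱼ ∈ 𝔪²` then all `cᵢ ∈ 𝔪`. [folklore] -/
theorem mem_maximalIdeal_of_sum_mul_mem_sq_of_rsop [IsRegularLocalRing R] {r e : ℕ}
    (x : Fin r → R) (y : Fin e → R) (hdim : ringKrullDim R = (r + e : ℕ))
    (hspan : Ideal.span (Set.range x ∪ Set.range y) = maximalIdeal R)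
    (c : Fin r → R) (c' : Fin e → R)
    (hc : ∑ i, c i * x i + ∑ j, c' j * y j ∈ (maximalIdeal R) ^ 2) (i : Fin r) :
    c i ∈ maximalIdeal R := by
  have hd := spanFinrank_eq_of_ringKrullDim_eq hdim
  have hz := (span_range_append x y).trans hspan
  have hsum : ∑ j, Fin.append c c' j * Fin.append x y j =
      ∑ i, c i * x i + ∑ j, c' j * y j := by
    rw [Fin.sum_univ_add]
    simp
  have := mem_maximalIdeal_of_sum_mul_rsop_mem_sq hd (Fin.append x y) hz (Fin.append c c')
    (hsum ▸ hc) (Fin.castAdd e i)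
  simpa using this

/-- **Extension of elements linearly independent mod `𝔪²` to a minimal system of generators of
`𝔪`** (regular local ring `A`, so `𝔪` needs exactly `dim A` generators): if
`f₁, …, f_r ∈ 𝔪` satisfy "`∑ cᵢ fᵢ ∈ 𝔪²` forces all `cᵢ ∈ 𝔪`" then there are
`y₁, …, y_e` with `(f, y)` generating `𝔪` and `r + e = dim A` (extend the images in `𝔪/𝔪²` to
a basis, lift, and apply Nakayama). [folklore] -/
theorem exists_extend_to_rsop [IsRegularLocalRing R] {r : ℕ} (f : Fin r → R)
    (hf : ∀ i, f i ∈ maximalIdeal R)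
    (hind : ∀ c : Fin r → R, ∑ i, c i * f i ∈ (maximalIdeal R) ^ 2 → ∀ i, c i ∈ maximalIdeal R) :
    ∃ (e : ℕ) (y : Fin e → R), ringKrullDim R = (r + e : ℕ) ∧
      Ideal.span (Set.range f ∪ Set.range y) = maximalIdeal R := by
  classical
  let κ := ResidueField R
  let m := maximalIdeal R
  let V := CotangentSpace R
  let v : Fin r → V := fun i => m.toCotangent ⟨f i, hf i⟩
  -- the `vᵢ` are linearly independent
  have hli : LinearIndependent κ v := by
    rw [Fintype.linearIndependent_iff]
    intro g hg i
    choose c hc using fun i => Ideal.Quotient.mk_surjective (g i)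
    have hsum : m.toCotangent (∑ i, c i • (⟨f i, hf i⟩ : m)) = 0 := by
      rw [map_sum, ← hg]
      refine Finset.sum_congr rfl fun i _ => ?_
      rw [LinearMap.map_smul_of_tower, ← hc i]
      rfl
    have hmem : (∑ i, c i * f i) ∈ m ^ 2 := by
      have := (m.toCotangent_eq_zero _).mp hsum
      simpa [Submodule.coe_sum, smul_eq_mul] using this
    rw [← hc i]
    exact Ideal.Quotient.eq_zero_iff_mem.mpr (hind c hmem i)
  -- a complement of the span of the `vᵢ` and a basis of it
  haveI : IsNoetherianRing R := inferInstance
  obtain ⟨q, hq⟩ := Submodule.exists_isCompl (Submodule.span κ (Set.range v))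
  let e := Module.finrank κ q
  let bq := Module.finBasis κ q
  -- lift the basis vectors of the complement to `𝔪`
  choose w hw using fun j : Fin e => m.toCotangent_surjective (bq j : V)
  refine ⟨e, fun j => (w j : R), ?_, ?_⟩
  · -- dimension count: `dim R = emb dim R = finrank V = r + e`
    have h1 : (Module.finrank κ V : ℕ) = r + e := by
      have hp : Module.finrank κ (Submodule.span κ (Set.range v)) = r := by
        rw [finrank_span_eq_card hli, Fintype.card_fin]
      rw [← Submodule.finrank_add_eq_of_isCompl hq, hp]
    have h2 := IsRegularLocalRing.spanFinrank_maximalIdeal (R := R)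
    rw [IsLocalRing.spanFinrank_maximalIdeal_eq_finrank_cotangentSpace] at h2
    rw [← h2]
    exact_mod_cast congrArg (fun n : ℕ => (n : WithBot ℕ∞)) h1
  · -- `(f, w)` generate `𝔪` by Nakayama (their images span `𝔪/𝔪²`)
    let s : Set m := Set.range (fun i => (⟨f i, hf i⟩ : m)) ∪ Set.range w
    have hs : Submodule.span κ (m.toCotangent '' s) = ⊤ := by
      have himage : m.toCotangent '' s = Set.range v ∪ Set.range (fun j => (bq j : V)) := by
        rw [Set.image_union, ← Set.range_comp, ← Set.range_comp]
        exact congrArg₂ (· ∪ ·) rfl (congrArg Set.range (funext hw))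
      rw [himage, Submodule.span_union]
      have : Submodule.span κ (Set.range fun j => (bq j : V)) = q := by
        have := congrArg (Submodule.map q.subtype) bq.span_eq
        rw [Submodule.map_span, Submodule.map_top, Submodule.range_subtype,
          ← Set.range_comp] at this
        exact this
      rw [this]
      exact hq.sup_eq_top
    have hs' : Submodule.span R s = ⊤ := (CotangentSpace.span_image_eq_top_iff).mp hs
    have := congrArg (Submodule.map m.subtype) hs'
    rw [Submodule.map_span, Submodule.map_top, Submodule.range_subtype] at this
    refine Eq.trans ?_ this
    change Submodule.span R _ = Submodule.span R _
    congr 1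
    ext a
    simp only [s, Set.image_union, ← Set.range_comp, Set.mem_union, Set.mem_range,
      Function.comp_apply, Submodule.subtype_apply]

end MinimalGenerators

/-! ## Descent along a flat local homomorphism -/

section LocalDescent

variable {A B : Type u} [CommRing A] [CommRing B] [IsLocalRing A] [IsLocalRing B]

/-- Independence mod `𝔪²` is reflected by a local homomorphism along which the elements become
unit multiples of independent elements: if `φ(fᵢ) = uᵢ xᵢ` with `uᵢ` units and
"`∑ cᵢ xᵢ + ∑ c'ⱼ yⱼ ∈ 𝔪_B²` forces `cᵢ ∈ 𝔪_B`", then "`∑ cᵢ fᵢ ∈ 𝔪_A²` forces `cᵢ ∈ 𝔪_A`".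
[folklore] -/
theorem indep_of_map_eq_unit_mul (φ : A →+* B) [IsLocalHom φ] {r e : ℕ} (x : Fin r → B)
    (y : Fin e → B)
    (hxy : ∀ (c : Fin r → B) (c' : Fin e → B),
      ∑ i, c i * x i + ∑ j, c' j * y j ∈ (maximalIdeal B) ^ 2 → ∀ i, c i ∈ maximalIdeal B)
    (f : Fin r → A) (u : Fin r → B) (hu : ∀ i, IsUnit (u i)) (hf : ∀ i, φ (f i) = u i * x i)
    (c : Fin r → A) (hc : ∑ i, c i * f i ∈ (maximalIdeal A) ^ 2) (i : Fin r) :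
    c i ∈ maximalIdeal A := by
  have hmap : φ (∑ i, c i * f i) ∈ (maximalIdeal B) ^ 2 := by
    have h1 : (maximalIdeal A).map φ ≤ maximalIdeal B :=
      ((IsLocalRing.local_hom_TFAE φ).out 0 2).mp ‹_›
    have : ((maximalIdeal A) ^ 2).map φ ≤ (maximalIdeal B) ^ 2 := by
      rw [Ideal.map_pow]
      exact Ideal.pow_right_mono h1 2
    exact this (Ideal.mem_map_of_mem φ hc)
  rw [map_sum] at hmap
  simp_rw [map_mul, hf, ← mul_assoc] at hmap
  have h := hxy (fun i => φ (c i) * u i) (fun _ => 0) (by simpa using hmap) i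
  -- `φ(cᵢ) uᵢ ∈ 𝔪_B` with `uᵢ` a unit, so `φ(cᵢ)` is not a unit, so `cᵢ` is not a unit
  have h' : φ (c i) ∈ maximalIdeal B := by
    rw [mem_maximalIdeal, mem_nonunits_iff] at h ⊢
    exact fun hci => h (hci.mul (hu i))
  rw [mem_maximalIdeal, mem_nonunits_iff] at h' ⊢
  exact fun hci => h' (hci.map φ)

omit [IsLocalRing A] in
/-- **A finitely generated ideal which becomes principal after a faithfully flat local extension
is principal**, generated by one of its elements whose image generates the extended ideal:
if `Q·B = (x)` in the local domain `B` then `Q = (f)` with `(φ f) = (x)` (write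
`x = ∑ bₗ φ(gₗ)` and `φ(gₗ) = cₗ x` over generators `gₗ` of `Q`; some `cₗ` is a unit, and
`Q = (gₗ)` by `IB ∩ A = I`). [folklore] -/
theorem exists_eq_span_singleton_of_map_eq_span_singleton [Algebra A B]
    [Module.FaithfullyFlat A B] [IsNoetherianRing A] [IsDomain B] (Q : Ideal A) (x : B)
    (hQ : Q.map (algebraMap A B) = Ideal.span {x}) :
    ∃ f : A, Q = Ideal.span {f} ∧ Ideal.span {algebraMap A B f} = Ideal.span {x} := by
  classical
  by_cases hx : x = 0
  · subst hx
    refine ⟨0, ?_, by simp⟩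
    rw [Set.singleton_zero, Ideal.span_zero] at hQ ⊢
    rw [← Ideal.comap_map_eq_self_of_faithfullyFlat (B := B) Q, hQ]
    exact (RingHom.injective_iff_ker_eq_bot _).mp (FaithfulSMul.algebraMap_injective A B)
  obtain ⟨s, hs⟩ := (IsNoetherian.noetherian Q : Q.FG)
  -- `x = ∑ cᵢ φ(gᵢ)` over the generators `gᵢ ∈ s`
  have hxmem : x ∈ Submodule.span B ((algebraMap A B) '' (s : Set A)) := by
    have : Q.map (algebraMap A B) = Ideal.span ((algebraMap A B) '' (s : Set A)) := by
      rw [← Ideal.map_span]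
      exact congrArg _ hs.symm
    change x ∈ Ideal.span _
    rw [← this, hQ]
    exact Ideal.mem_span_singleton_self x
  obtain ⟨c, hcx⟩ := (Fintype.mem_span_image_iff_exists_fun B).mp hxmem
  -- `φ(g) = d_g x` for `g ∈ s`
  have hd : ∀ g : (s : Set A), ∃ d : B, d * x = algebraMap A B g := by
    intro g
    have : algebraMap A B g ∈ Ideal.span {x} := by
      rw [← hQ]
      exact Ideal.mem_map_of_mem _ (hs ▸ Ideal.subset_span g.2)
    exact Ideal.mem_span_singleton'.mp this
  choose d hd using hd
  -- `∑ cᵢ dᵢ = 1`, so some `dᵢ` is a unit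
  have hsum : ∑ g, c g * d g = 1 := by
    have h1 : (∑ g, c g * d g) * x = 1 * x := by
      rw [Finset.sum_mul, one_mul]
      conv_rhs => rw [← hcx]
      refine Finset.sum_congr rfl fun g _ => ?_
      rw [mul_assoc, hd g, smul_eq_mul]
    exact mul_right_cancel₀ hx h1
  obtain ⟨g, hg⟩ : ∃ g, IsUnit (d g) := by
    by_contra hall
    push Not at hall
    have : ∑ g, c g * d g ∈ maximalIdeal B :=
      Ideal.sum_mem _ fun g _ => Ideal.mul_mem_left _ _ (by
        rw [mem_maximalIdeal, mem_nonunits_iff]; exact hall g)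
    rw [hsum] at this
    exact (maximalIdeal.isMaximal B).ne_top ((Ideal.eq_top_iff_one _).mpr this)
  -- then `(φ g) = (x)` and `Q = (g)`
  have hspan : Ideal.span {algebraMap A B g} = Ideal.span {x} := by
    rw [Ideal.span_singleton_eq_span_singleton]
    exact ⟨hg.unit⁻¹, by rw [← hd g, mul_comm (d g), mul_assoc, IsUnit.mul_val_inv, mul_one]⟩
  refine ⟨g, ?_, hspan⟩
  rw [← Ideal.comap_map_eq_self_of_faithfullyFlat (B := B) Q,
    ← Ideal.comap_map_eq_self_of_faithfullyFlat (B := B) (Ideal.span {(g : A)}), hQ,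
    Ideal.map_span, Set.image_singleton, hspan]

end LocalDescent

section LocalDescentMain

variable {A B : Type u} [CommRing A] [CommRing B] [IsLocalRing A] [IsNoetherianRing A]
  [IsRegularLocalRing B]

/-- **Local form of the descent of strict normal crossings**: let `φ : A → B` be a flat local
homomorphism from a Noetherian local ring to a regular local ring, `(x₁,…,x_r ; y₁,…,y_e)` a
regular system of parameters of `B` (`r ≥ 1`), `I ⊆ A` an ideal with `I·B = (x₁ ⋯ x_r)` and
`Q₁, …, Q_r ⊆ A` ideals with `Qᵢ·B = (xᵢ)`. Then `A` is regular (Matsumura 23.7) and has a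
regular system of parameters `(x'₁,…,x'_r ; y')` with `I = (x'₁ ⋯ x'_r)`: `Qᵢ = (x'ᵢ)` with
`φ(x'ᵢ)` a unit multiple of `xᵢ`, the `x'ᵢ` are independent mod `𝔪_A²` and extend to minimal
generators of `𝔪_A`, and `I = (∏ x'ᵢ)` by `IB ∩ A = I`. [folklore] -/
theorem isRegularLocalRing_and_exists_rsop_of_flat (φ : A →+* B) (hφ : φ.Flat) [IsLocalHom φ]
    {r e : ℕ} (x : Fin r → B) (y : Fin e → B)
    (hr : 1 ≤ r) (hdim : ringKrullDim B = (r + e : ℕ))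
    (hspan : Ideal.span (Set.range x ∪ Set.range y) = maximalIdeal B) (I : Ideal A)
    (hI : I.map φ = Ideal.span {∏ i, x i}) (Q : Fin r → Ideal A)
    (hQ : ∀ i, (Q i).map φ = Ideal.span {x i}) :
    IsRegularLocalRing A ∧ ∃ (e' : ℕ) (x' : Fin r → A) (y' : Fin e' → A),
      1 ≤ r ∧ ringKrullDim A = (r + e' : ℕ) ∧
      Ideal.span (Set.range x' ∪ Set.range y') = maximalIdeal A ∧
      I = Ideal.span {∏ i, x' i} := by
  classical
  haveI hA : IsRegularLocalRing A := IsRegularLocalRing.of_flat_ringHom φ hφ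
  letI := φ.toAlgebra
  haveI : Module.Flat A B := hφ
  haveI : Module.FaithfullyFlat A B := Module.FaithfullyFlat.of_flat_of_isLocalHom
  haveI : IsDomain B := isDomain_of_isRegularLocalRing B
  -- `Qᵢ = (fᵢ)` with `(φ fᵢ) = (xᵢ)`, so `φ fᵢ = uᵢ xᵢ`
  have hf : ∀ i, ∃ f : A, Q i = Ideal.span {f} ∧ Ideal.span {φ f} = Ideal.span {x i} :=
    fun i => exists_eq_span_singleton_of_map_eq_span_singleton (Q i) (x i) (hQ i)
  choose f hQf hfx using hf
  have hu : ∀ i, ∃ u : B, IsUnit u ∧ φ (f i) = u * x i := by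
    intro i
    obtain ⟨u, hu⟩ := (Ideal.span_singleton_eq_span_singleton.mp (hfx i)).symm
    exact ⟨u, u.isUnit, by rw [← hu, mul_comm]⟩
  choose u hu hfu using hu
  -- the `xᵢ` lie in `𝔪_B`, so the `fᵢ` lie in `𝔪_A`
  have hxm : ∀ i, x i ∈ maximalIdeal B := fun i =>
    hspan ▸ Ideal.subset_span (Or.inl ⟨i, rfl⟩)
  have hfm : ∀ i, f i ∈ maximalIdeal A := by
    intro i
    have : φ (f i) ∈ maximalIdeal B := by
      rw [hfu i]
      exact Ideal.mul_mem_left _ _ (hxm i)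
    rw [mem_maximalIdeal, mem_nonunits_iff] at this ⊢
    exact fun h => this (h.map φ)
  -- independence of the `fᵢ` mod `𝔪_A²`
  have hind : ∀ c : Fin r → A, ∑ i, c i * f i ∈ (maximalIdeal A) ^ 2 →
      ∀ i, c i ∈ maximalIdeal A :=
    indep_of_map_eq_unit_mul φ x y
      (mem_maximalIdeal_of_sum_mul_mem_sq_of_rsop x y hdim hspan) f u hu hfu
  obtain ⟨e', y', hdim', hspan'⟩ := exists_extend_to_rsop f hfm hind
  refine ⟨hA, e', f, y', hr, hdim', hspan', ?_⟩
  -- `I = (∏ fᵢ)` by faithful flatness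
  have hprod : Ideal.span {φ (∏ i, f i)} = Ideal.span {∏ i, x i} := by
    rw [map_prod, Ideal.span_singleton_eq_span_singleton]
    simp_rw [hfu]
    rw [Finset.prod_mul_distrib]
    have hU : IsUnit (∏ i, u i) := IsUnit.prod_univ_iff.mpr hu
    refine ⟨hU.unit⁻¹, ?_⟩
    rw [mul_comm ((∏ i, u i) * ∏ i, x i), ← mul_assoc, IsUnit.val_inv_mul, one_mul]
  rw [← Ideal.comap_map_eq_self_of_faithfullyFlat (B := B) I,
    ← Ideal.comap_map_eq_self_of_faithfullyFlat (B := B) (Ideal.span {∏ i, f i})]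
  change (I.map φ).comap φ = ((Ideal.span {∏ i, f i}).map φ).comap φ
  rw [hI, Ideal.map_span, Set.image_singleton, hprod]

end LocalDescentMain


/-! ## Points of `Spec 𝒪_{Y,p}` and vanishing ideals -/

section StalkPoints

open Scheme.IdealSheafData

variable {Y : Scheme.{u}} {U : Y.Opens} (hU : IsAffineOpen U) {p : Y} (hpU : p ∈ U)

/-- The point of `Y` defined by a prime `𝔯 ⊆ 𝒪_{Y,p}` is the point of the affine open `U ∋ p`
defined by the contraction of `𝔯` to `Γ(Y, U)`. [folklore] -/
theorem fromSpecStalk_apply (𝔯 : PrimeSpectrum (Y.presheaf.stalk p)) :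
    Y.fromSpecStalk p 𝔯 = hU.fromSpec (PrimeSpectrum.comap (Y.presheaf.germ U p hpU).hom 𝔯) := by
  rw [← hU.fromSpecStalk_eq_fromSpecStalk hpU, IsAffineOpen.fromSpecStalk, Scheme.Hom.comp_apply]
  rfl

/-- The point defined by a prime of `𝒪_{Y,p}` lies in every open neighbourhood of `p` (it
generalizes `p`). [folklore] -/
theorem fromSpecStalk_mem {V : Y.Opens} (hpV : p ∈ V) (𝔯 : PrimeSpectrum (Y.presheaf.stalk p)) :
    Y.fromSpecStalk p 𝔯 ∈ V := by
  have h : Y.fromSpecStalk p 𝔯 ⤳ p := by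
    rw [← Set.mem_setOf_eq (p := fun y => y ⤳ p), ← Scheme.range_fromSpecStalk]
    exact ⟨𝔯, rfl⟩
  exact h.mem_open V.2 hpV

/-- A section over the affine open `U ∋ p` vanishes on the closed irreducible set
`closure {y_𝔯}` defined by a prime `𝔯 ⊆ 𝒪_{Y,p}` iff its germ at `p` lies in `𝔯`. [folklore] -/
theorem mem_vanishingIdeal_closure_fromSpecStalk_iff (𝔯 : PrimeSpectrum (Y.presheaf.stalk p))
    (g : Γ(Y, U)) :
    g ∈ (vanishingIdeal ⟨closure {Y.fromSpecStalk p 𝔯}, isClosed_closure⟩).ideal ⟨U, hU⟩ ↔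
      (Y.presheaf.germ U p hpU).hom g ∈ 𝔯.asIdeal := by
  rw [vanishingIdeal_ideal, PrimeSpectrum.mem_vanishingIdeal]
  constructor
  · intro h
    exact h _ (by
      change hU.fromSpec _ ∈ closure _
      rw [← fromSpecStalk_apply hU hpU]
      exact subset_closure rfl)
  · intro h P hP
    change hU.fromSpec P ∈ closure {Y.fromSpecStalk p 𝔯} at hP
    rw [fromSpecStalk_apply hU hpU] at hP
    -- `P` specializes the contraction of `𝔯` (fromSpec is an embedding)
    have hP' : P ∈ closure {PrimeSpectrum.comap (Y.presheaf.germ U p hpU).hom 𝔯} := by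
      have := hU.fromSpec.isOpenEmbedding.isEmbedding.closure_eq_preimage_closure_image
        {PrimeSpectrum.comap (Y.presheaf.germ U p hpU).hom 𝔯}
      have himg : (hU.fromSpec : _ → Y) '' {PrimeSpectrum.comap (Y.presheaf.germ U p hpU).hom 𝔯} =
          {hU.fromSpec (PrimeSpectrum.comap (Y.presheaf.germ U p hpU).hom 𝔯)} :=
        Set.image_singleton
      have hP2 : P ∈ hU.fromSpec ⁻¹' closure (hU.fromSpec ''
          {PrimeSpectrum.comap (Y.presheaf.germ U p hpU).hom 𝔯}) := by
        change hU.fromSpec P ∈ closure _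
        exact himg.symm ▸ hP
      exact this ▸ hP2
    have hle : PrimeSpectrum.comap (Y.presheaf.germ U p hpU).hom 𝔯 ≤ P :=
      (PrimeSpectrum.le_iff_specializes _ _).mpr (specializes_iff_mem_closure.mpr hP')
    exact hle h

/-- The extension to `𝒪_{Y,p}` of the sections over `U ∋ p` vanishing on `closure {y_𝔯}` is
`𝔯` (every ideal of the localization `𝒪_{Y,p}` of `Γ(Y, U)` is extended from its
contraction). [folklore] -/
theorem map_germ_vanishingIdeal_closure_fromSpecStalk (𝔯 : PrimeSpectrum (Y.presheaf.stalk p)) :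
    ((vanishingIdeal ⟨closure {Y.fromSpecStalk p 𝔯}, isClosed_closure⟩).ideal ⟨U, hU⟩).map
      (Y.presheaf.germ U p hpU).hom = 𝔯.asIdeal := by
  apply le_antisymm
  · rw [Ideal.map_le_iff_le_comap]
    intro g hg
    exact (mem_vanishingIdeal_closure_fromSpecStalk_iff hU hpU 𝔯 g).mp hg
  · -- `𝔯` is extended from its contraction, which consists of sections vanishing on the closure
    letI := Y.presheaf.algebra_section_stalk ⟨p, hpU⟩
    haveI := hU.isLocalization_stalk ⟨p, hpU⟩
    have h1 : 𝔯.asIdeal = (𝔯.asIdeal.under Γ(Y, U)).map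
        (algebraMap Γ(Y, U) (Y.presheaf.stalk p)) :=
      (IsLocalization.map_under (hU.primeIdealOf ⟨p, hpU⟩).asIdeal.primeCompl
        (S := Y.presheaf.stalk p) _).symm
    rw [h1]
    refine Ideal.map_mono fun g hg => ?_
    exact (mem_vanishingIdeal_closure_fromSpecStalk_iff hU hpU 𝔯 g).mpr hg

end StalkPoints

/-! ## Descent of strict normal crossings along a faithfully flat cover -/

section Descent

open Scheme.IdealSheafData

/-- **Strict normal crossings descend along a flat surjective affine morphism when the divisor
and its irreducible components descend scheme-theoretically.** Let `a : Y → Y'` be affine,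
flat and surjective, `Y'` locally Noetherian, `D' ⊆ Y'` closed with preimage `D = a⁻¹(D')`.
Suppose `D` is a strict normal crossings divisor in `Y`, the ideal sheaf of (the reduced
structure on) `D'` pulls back to that of `D`, and likewise for the image of every irreducible
component of `D`. Then `D'` is a strict normal crossings divisor in `Y'`: at `p' = a(p)` the local
ring `𝒪_{Y',p'} → 𝒪_{Y,p}` is flat local, so `𝒪_{Y',p'}` is regular (Matsumura 23.7); the
branches `(xᵢ)` of `D` at `p` are the stalks of the ideals of the components of `D` through the
corresponding generizations of `p`, hence extended from `𝒪_{Y',p'}`, and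
`isRegularLocalRing_and_exists_rsop_of_flat` applies. (The hypothesis on components cannot be
dropped: `x² - t y² = 0` over `k(t)`, `char k ≠ 2`, becomes the normal crossing of two lines
over `k(√t)` but is irreducible and singular at the origin over `k(t)`.) [folklore] -/
theorem IsStrictNormalCrossingsDivisor.of_comap_vanishingIdeal {Y Y' : Scheme.{u}} (a : Y ⟶ Y')
    [IsAffineHom a] [Flat a] [Surjective a] [IsLocallyNoetherian Y'] {D' : Set Y'}
    (hD' : IsClosed D') (h1 : IsStrictNormalCrossingsDivisor Y (a ⁻¹' D'))
    (h2 : (vanishingIdeal ⟨D', hD'⟩).comap a =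
      vanishingIdeal ⟨a ⁻¹' D', hD'.preimage a.continuous⟩)
    (h3 : ∀ (C : Set Y) (hC : IsClosed C), Maximal (fun C => IsIrreducible C ∧ C ⊆ a ⁻¹' D') C →
      (vanishingIdeal ⟨closure (a '' C), isClosed_closure⟩).comap a = vanishingIdeal ⟨C, hC⟩) :
    IsStrictNormalCrossingsDivisor Y' D' := by
  classical
  refine ⟨hD', fun p' hp' => ?_⟩
  obtain ⟨p, rfl⟩ := a.surjective p'
  have hp : p ∈ a ⁻¹' D' := hp'
  obtain ⟨hregB, r, e, x, y, hr, hdim, hspan, hI⟩ := h1.2 p hp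
  have hcl : (⟨closure (a ⁻¹' D'), isClosed_closure⟩ : Closeds Y) =
      ⟨a ⁻¹' D', hD'.preimage a.continuous⟩ :=
    Closeds.ext (hD'.preimage a.continuous).closure_eq
  rw [hcl] at hI
  -- an affine open neighbourhood `U'` of `a p` and `U = a⁻¹U'`
  obtain ⟨U', hU', hpU', -⟩ := exists_isAffineOpen_mem_and_subset (X := Y') (x := a p)
    (U := ⊤) trivial
  have hU : IsAffineOpen (a ⁻¹ᵁ U') := hU'.preimage a
  have hpU : p ∈ a ⁻¹ᵁ U' := hpU'
  -- the flat local homomorphism `φ : A = 𝒪_{Y', a p} → B = 𝒪_{Y, p}`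
  let φ := (a.stalkMap p).hom
  have hφ : φ.Flat := Flat.stalkMap a p
  let gA := (Y'.presheaf.germ U' (a p) hpU').hom
  let gB := (Y.presheaf.germ (a ⁻¹ᵁ U') p hpU).hom
  have hcomp : φ.comp gA = gB.comp (a.app U').hom := by
    ext g
    exact Scheme.Hom.germ_stalkMap_apply a U' p hpU' g
  have key : ∀ J' : Y'.IdealSheafData,
      ((J'.ideal ⟨U', hU'⟩).map gA).map φ = ((J'.comap a).ideal ⟨a ⁻¹ᵁ U', hU⟩).map gB := by
    intro J'
    rw [Ideal.map_map, hcomp, ← Ideal.map_map, ← ideal_comap_preimage_of_isAffineHom J' a ⟨U', hU'⟩]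
  -- the ideal `I` of `D'` at `a p` extends to `(x₁ ⋯ x_r)`
  let I := ((vanishingIdeal ⟨D', hD'⟩).ideal ⟨U', hU'⟩).map gA
  have hI' : I.map φ = Ideal.span {∏ i, x i} := by
    rw [key, h2]
    exact hI ⟨a ⁻¹ᵁ U', hU⟩ hpU
  -- the branches `(xᵢ)` at `p`: prime ideals of `B`, points `qᵢ` of `Y`, closures `Gᵢ`
  let B := Y.presheaf.stalk p
  haveI : IsRegularLocalRing B := hregB
  have hprime : ∀ i, (Ideal.span {x i}).IsPrime := isPrime_span_singleton_of_rsop x y hdim hspan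
  let 𝔮 : Fin r → PrimeSpectrum B := fun i => ⟨Ideal.span {x i}, hprime i⟩
  let q : Fin r → Y := fun i => Y.fromSpecStalk p (𝔮 i)
  let G : Fin r → Set Y := fun i => closure {q i}
  -- a point `y_𝔯` of `Spec B ⊆ Y` lies in `D` iff `x₁ ⋯ x_r ∈ 𝔯`
  have hmemD : ∀ 𝔯 : PrimeSpectrum B,
      Y.fromSpecStalk p 𝔯 ∈ a ⁻¹' D' ↔ ∏ j, x j ∈ 𝔯.asIdeal := by
    intro 𝔯
    have hyU : Y.fromSpecStalk p 𝔯 ∈ a ⁻¹ᵁ U' := fromSpecStalk_mem hpU 𝔯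
    have h0 : Y.fromSpecStalk p 𝔯 ∈ a ⁻¹' D' ↔ Y.fromSpecStalk p 𝔯 ∈
        (vanishingIdeal ⟨a ⁻¹' D', hD'.preimage a.continuous⟩).support := by
      rw [← SetLike.mem_coe, coe_support_vanishingIdeal]
      rfl
    rw [h0, mem_support_iff_of_mem (U := ⟨a ⁻¹ᵁ U', hU⟩) hyU, Scheme.mem_zeroLocus_iff,
      ← Ideal.span_singleton_le_iff_mem, ← hI ⟨a ⁻¹ᵁ U', hU⟩ hpU, Ideal.map_le_iff_le_comap]
    refine forall₂_congr fun g hg => ?_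
    rw [Ideal.mem_comap, fromSpecStalk_apply hU hpU 𝔯, ← Scheme.Hom.mem_preimage]
    erw [hU.fromSpec_preimage_basicOpen g]
    change _ ∉ PrimeSpectrum.basicOpen g ↔ _
    rw [PrimeSpectrum.mem_basicOpen, not_not]
    rfl
  have hprod_mem : ∀ i, ∏ j, x j ∈ (𝔮 i).asIdeal := fun i =>
    Ideal.mem_span_singleton.mpr (Finset.dvd_prod_of_mem x (Finset.mem_univ i))
  have hqD : ∀ i, q i ∈ a ⁻¹' D' := fun i => (hmemD (𝔮 i)).mpr (hprod_mem i)
  have hGD : ∀ i, G i ⊆ a ⁻¹' D' := fun i =>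
    closure_minimal (Set.singleton_subset_iff.mpr (hqD i)) (hD'.preimage a.continuous)
  -- `Gᵢ` is an irreducible component of `D`
  have hGmax : ∀ i, Maximal (fun C => IsIrreducible C ∧ C ⊆ a ⁻¹' D') (G i) := by
    intro i
    refine ⟨⟨isIrreducible_singleton.closure, hGD i⟩, ?_⟩
    rintro C ⟨hCirr, hCD⟩ hGC
    have hξ := hCirr.isGenericPoint_genericPoint_closure
    set ξ := hCirr.genericPoint
    have hqC : q i ∈ closure C := subset_closure (hGC (subset_closure rfl))
    have h1 : ξ ⤳ q i := hξ.specializes hqC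
    have hqp : q i ⤳ p := by
      have : q i ∈ Set.range (Y.fromSpecStalk p) := ⟨𝔮 i, rfl⟩
      rwa [Scheme.range_fromSpecStalk] at this
    obtain ⟨𝔯, h𝔯⟩ : ξ ∈ Set.range (Y.fromSpecStalk p) := by
      rw [Scheme.range_fromSpecStalk]
      exact h1.trans hqp
    have h3 : 𝔯 ⤳ 𝔮 i := by
      rw [← (Y.fromSpecStalk p).isEmbedding.specializes_iff, h𝔯]
      exact h1
    have h4 : 𝔯.asIdeal ≤ Ideal.span {x i} := (PrimeSpectrum.le_iff_specializes _ _).mpr h3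
    have h5 : ∏ j, x j ∈ 𝔯.asIdeal := by
      rw [← hmemD 𝔯, h𝔯]
      exact (closure_minimal hCD (hD'.preimage a.continuous)) hξ.mem
    obtain ⟨l, -, hl⟩ := (Ideal.IsPrime.prod_mem_iff (p := 𝔯.asIdeal)).mp h5
    have hli : l = i := eq_of_rsop_mem_span_singleton x y hdim hspan (h4 hl)
    subst hli
    have h6 : 𝔯 = 𝔮 l :=
      PrimeSpectrum.ext (le_antisymm h4 ((Ideal.span_singleton_le_iff_mem _).mpr hl))
    have h7 : ξ = q l := by rw [← h𝔯, h6]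
    calc C ⊆ closure C := subset_closure
      _ = G l := by rw [← hξ.def, h7]
  -- the ideals `Qᵢ` of the images of the components at `a p`
  let Q : Fin r → Ideal (Y'.presheaf.stalk (a p)) := fun i =>
    ((vanishingIdeal ⟨closure (a '' G i), isClosed_closure⟩).ideal ⟨U', hU'⟩).map gA
  have hQ : ∀ i, (Q i).map φ = Ideal.span {x i} := by
    intro i
    change (((vanishingIdeal ⟨closure (a '' G i), isClosed_closure⟩).ideal ⟨U', hU'⟩).map gA).map
      φ = _
    rw [key, h3 (G i) isClosed_closure (hGmax i)]
    exact map_germ_vanishingIdeal_closure_fromSpecStalk hU hpU (𝔮 i)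
  -- the local algebra
  obtain ⟨hA, e', x', y', hr', hdimA, hspanA, hIA⟩ :=
    isRegularLocalRing_and_exists_rsop_of_flat φ hφ x y hr hdim hspan I hI' Q hQ
  refine ⟨hA, r, e', x', y', hr', hdimA, hspanA, fun U'' hU'' => ?_⟩
  have hcl' : (⟨closure D', isClosed_closure⟩ : Closeds Y') = ⟨D', hD'⟩ :=
    Closeds.ext hD'.closure_eq
  rw [hcl', map_germ_eq_map_germ (vanishingIdeal ⟨D', hD'⟩) U'' ⟨U', hU'⟩ hU'' hpU']
  exact hIA

end Descent

end Literature.AlgebraicGeometry.Resolution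

end
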